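import Summits.RiemannHypothesis.RiemannHypothesis.Theorems.TiltedLandingLaw421Seam05

/-! # TiltedLandingLaw421 — descent seam, part 06
Token-identical port of the descent framework of `Cruxes/TiltedLandingLaw421/Lines/law421birthS.lean`
(seam canon ce03e18b) into flat Theorems modules, so that crux line files can import it instead of inlining it.
No new mathematics; no `sorry`; no route (Theses) imports — the tree statement is mirrored as `RhW07.Seam.Law421Statement`. -/

open Complex Metric Set
open scoped ComplexConjugate
namespace RhIdea6.G19.W07C11.Seam
open Set Complex
open Summit.RiemannHypothesis.RiemannHypothesis.Theorems.Splittings.JensenWindow (LocalA)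
open RhIdea6.G17.W07C7 RhIdea6.G17.W07C7.Rev6 RhIdea6.G18.W07C8.Law421BirthS
section Lift
open scoped BigOperators

/-- `descentSigC_of_lift_pieces` — seam of the TiltedLandingLaw421 descent framework, part 06 (token-identical port of `Cruxes/TiltedLandingLaw421/Lines/law421birthS.lean`; no new mathematics). -/
theorem descentSigC_of_lift_pieces (μ cE c : ℝ) (Λ : ℝ → ℝ → ℝ) (hμ : 0 < μ) (hc : 0 ≤ c)
    (hbud : ∀ s hmax : ℝ, 0 < s → 2 * s ≤ hmax → hmax / (μ * s) + cE + Λ s hmax / (μ * s) ≤ 4 * hmax / s + c)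
    (St Ready Frozen : StatePred)
    (hI : Init0Sig St) (hSL : SurplusLiftSig cE Λ St Ready Frozen) (hF : FrozenStepSig μ St Ready Frozen)
    (hL : LandSig St Ready) : DescentSigC c := by
  intro η f x₀ s hmax R Hs B hE
  have hE' := hE
  obtain ⟨-, -, -, hs, hsh, -, -, -, -, -, -, -, -, -, -, -⟩ := hE'
  have hμs : 0 < μ * s := mul_pos hμ hs
  obtain ⟨E, lam, hEcard, hlam0, hlamsum, hEoff, hEon⟩ := hSL η f x₀ s hmax R Hs B hE
  obtain ⟨u₀, hSt0, hu₀⟩ := hI η f x₀ s hmax R Hs B hE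

  let S : ℕ → Finset ℕ := fun j => E.filter (fun e => j ≤ e)
  let w : ℕ → ℝ := fun e => 1 + lam e / (μ * s)
  let W : ℕ → ℝ := fun j => ∑ e ∈ S j, w e
  let Φ : ℕ → ℂ → ℝ := fun j u => |u.im| / (μ * s) + W j
  have hw0 : ∀ e, 0 ≤ w e := fun e => by
    have : 0 ≤ lam e / (μ * s) := div_nonneg (hlam0 e) hμs.le
    simp only [w]; linarith
  have hSins : ∀ j : ℕ, j ∈ E → S j = insert j (S (j + 1)) := by
    intro j hj
    ext e
    simp only [S, Finset.mem_filter, Finset.mem_insert]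
    constructor
    · rintro ⟨he, hle⟩
      by_cases h : e = j
      · exact Or.inl h
      · exact Or.inr ⟨he, by omega⟩
    · rintro (h | ⟨he, hle⟩)
      · subst h; exact ⟨hj, le_rfl⟩
      · exact ⟨he, by omega⟩
  have hSeq : ∀ j : ℕ, j ∉ E → S (j + 1) = S j := by
    intro j hj
    ext e
    simp only [S, Finset.mem_filter]
    constructor
    · rintro ⟨he, hle⟩; exact ⟨he, by omega⟩
    · rintro ⟨he, hle⟩
      have hne : j ≠ e := fun h => hj (h ▸ he)
      exact ⟨he, by omega⟩
  have hWon : ∀ j : ℕ, j ∈ E → W j = w j + W (j + 1) := by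
    intro j hj
    have hnot : j ∉ S (j + 1) := by
      simp only [S, Finset.mem_filter, not_and, not_le]
      intro _; omega
    simp only [W]
    rw [hSins j hj, Finset.sum_insert hnot]
  have hWoff : ∀ j : ℕ, j ∉ E → W (j + 1) = W j := by
    intro j hj
    simp only [W]
    rw [hSeq j hj]
  have hWnonneg : ∀ j, 0 ≤ W j := fun j => Finset.sum_nonneg (fun e _ => hw0 e)
  have hΦnonneg : ∀ (j : ℕ) (u : ℂ), 0 ≤ Φ j u := by
    intro j u
    have : 0 ≤ |u.im| / (μ * s) := div_nonneg (abs_nonneg _) hμs.le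
    have := hWnonneg j
    simp only [Φ]
    linarith

  have hStep : ∀ (j : ℕ) (u : ℂ), St η f x₀ s hmax R Hs B j u → ¬ Ready η f x₀ s hmax R Hs B j u →
      ∃ u' : ℂ, St η f x₀ s hmax R Hs B (j + 1) u' ∧ 0 ≤ Φ (j + 1) u' ∧ Φ (j + 1) u' + 1 ≤ Φ j u := by
    intro j u hSt hR
    by_cases hjE : j ∈ E
    ·
      obtain ⟨u', hSt', hle⟩ := hEon j u hjE hSt hR
      have hWj := hWon j hjE
      have hh : |u'.im| / (μ * s) ≤ |u.im| / (μ * s) + lam j / (μ * s) := by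
        rw [← add_div]
        exact div_le_div_of_nonneg_right hle hμs.le
      refine ⟨u', hSt', hΦnonneg _ _, ?_⟩
      simp only [Φ]
      simp only [w] at hWj
      linarith
    ·
      rcases hEoff j u hjE hSt with hRj | hFz
      · exact absurd hRj hR
      obtain ⟨u', hSt', hdrop⟩ := hF η f x₀ s hmax R Hs B hE j u hSt hFz hR
      have hh : |u'.im| / (μ * s) + 1 ≤ |u.im| / (μ * s) := by
        rw [← sub_nonneg]
        have hne : μ * s ≠ 0 := ne_of_gt hμs
        have : |u.im| / (μ * s) - (|u'.im| / (μ * s) + 1) = (|u.im| - |u'.im| - μ * s) / (μ * s) := by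
          field_simp
          ring
        rw [this]
        exact div_nonneg (by linarith) hμs.le
      have hWj := hWoff j hjE
      refine ⟨u', hSt', hΦnonneg _ _, ?_⟩
      simp only [Φ]
      linarith

  have hW0 : W 0 ≤ (Hs / s) ^ 2 + B + cE + Λ s hmax / (μ * s) := by
    have hsub : S 0 ⊆ E := Finset.filter_subset _ _
    have h1 : W 0 ≤ ∑ e ∈ E, w e := Finset.sum_le_sum_of_subset_of_nonneg hsub (fun e _ _ => hw0 e)
    have h2 : ∑ e ∈ E, w e = (E.card : ℝ) + (∑ e ∈ E, lam e) / (μ * s) := by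
      simp only [w, Finset.sum_add_distrib, Finset.sum_const, nsmul_eq_mul, mul_one, Finset.sum_div]
    have h3 : (∑ e ∈ E, lam e) / (μ * s) ≤ Λ s hmax / (μ * s) := div_le_div_of_nonneg_right hlamsum hμs.le
    linarith
  have hΦ0 : Φ 0 u₀ ≤ 4 * hmax / s + (Hs / s) ^ 2 + B + c := by
    have h1 : |u₀.im| / (μ * s) ≤ hmax / (μ * s) := div_le_div_of_nonneg_right hu₀ hμs.le
    have h2 := hbud s hmax hs hsh
    simp only [Φ]
    linarith
  obtain ⟨j, u, hj, hSt, hR⟩ :=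
    descent_core (St := St η f x₀ s hmax R Hs B) (Ready := Ready η f x₀ s hmax R Hs B) (Φ := Φ)
      hStep hSt0 hΦ0 (allowance_nonneg hs hsh hc)
  obtain ⟨hnz, α, β, H, hα, hβ, hW⟩ := hL η f x₀ s hmax R Hs B hE j u hSt hR
  exact ⟨j, α, β, H, hj, hα, hβ, hnz, hW⟩

/-- `liftBudget` — seam of the TiltedLandingLaw421 descent framework, part 06 (token-identical port of `Cruxes/TiltedLandingLaw421/Lines/law421birthS.lean`; no new mathematics). -/
def liftBudget (μ cE c : ℝ) : ℝ → ℝ → ℝ := fun s hmax => (4 * μ - 1) * hmax + (c - cE) * μ * s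

/-- `liftBudget_holds` — seam of the TiltedLandingLaw421 descent framework, part 06 (token-identical port of `Cruxes/TiltedLandingLaw421/Lines/law421birthS.lean`; no new mathematics). -/
theorem liftBudget_holds (μ cE c : ℝ) (hμ : 0 < μ) (s hmax : ℝ) (hs : 0 < s) (_hsh : 2 * s ≤ hmax) :
    hmax / (μ * s) + cE + liftBudget μ cE c s hmax / (μ * s) ≤ 4 * hmax / s + c := by
  have hμs : μ * s ≠ 0 := ne_of_gt (mul_pos hμ hs)
  have hs' : s ≠ 0 := ne_of_gt hs
  have hμ' : μ ≠ 0 := ne_of_gt hμ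
  apply le_of_eq
  simp only [liftBudget]
  field_simp
  ring

/-- `descentSigS'_of_lift_pieces` — seam of the TiltedLandingLaw421 descent framework, part 06 (token-identical port of `Cruxes/TiltedLandingLaw421/Lines/law421birthS.lean`; no new mathematics). -/
theorem descentSigS'_of_lift_pieces (μ : ℝ) (hμ : 1 / 4 ≤ μ) (St Ready Frozen : StatePred)
    (hI : Init0Sig St) (hSL : SurplusLiftSig 0 (liftBudget μ 0 1) St Ready Frozen) (hF : FrozenStepSig μ St Ready Frozen)
    (hL : LandSig St Ready) : DescentSigS' :=
  descentSigS'_of_descentSigC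
    (descentSigC_of_lift_pieces μ 0 1 (liftBudget μ 0 1) (by linarith) zero_le_one
      (fun s hmax hs hsh => liftBudget_holds μ 0 1 (by linarith) s hmax hs hsh) St Ready Frozen hI hSL hF hL)

/-- `descentSigS_of_lift_pieces` — seam of the TiltedLandingLaw421 descent framework, part 06 (token-identical port of `Cruxes/TiltedLandingLaw421/Lines/law421birthS.lean`; no new mathematics). -/
theorem descentSigS_of_lift_pieces (μ : ℝ) (hμ : 1 / 4 ≤ μ) (St Ready Frozen : StatePred)
    (hI : Init0Sig St) (hSL : SurplusLiftSig 0 (liftBudget μ 0 0) St Ready Frozen) (hF : FrozenStepSig μ St Ready Frozen)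
    (hL : LandSig St Ready) : DescentSigS :=
  descentSigS_of_descentSigC
    (descentSigC_of_lift_pieces μ 0 0 (liftBudget μ 0 0) (by linarith) le_rfl
      (fun s hmax hs hsh => liftBudget_holds μ 0 0 (by linarith) s hmax hs hsh) St Ready Frozen hI hSL hF hL)

example (s hmax : ℝ) : liftBudget (1 / 4) 0 1 s hmax = s / 4 := by simp only [liftBudget]; ring

example (s hmax : ℝ) : liftBudget (1 / 4) 0 0 s hmax = 0 := by simp only [liftBudget]; ring

/-- `SurplusLiftSigV` — seam of the TiltedLandingLaw421 descent framework, part 06 (token-identical port of `Cruxes/TiltedLandingLaw421/Lines/law421birthS.lean`; no new mathematics). -/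
def SurplusLiftSigV (μ : ℝ) (St Ready Frozen : StatePred) : Prop :=
  ∀ (η : ℝ) (f : ℂ → ℂ) (x₀ s hmax R Hs : ℝ) (B : ℕ), EngineHyps5 2 η f x₀ s hmax R Hs B →
    ∃ (E : Finset ℕ) (lam : ℕ → ℝ), (∀ j : ℕ, 0 ≤ lam j) ∧
      (E.card : ℝ) + (∑ e ∈ E, lam e) / (μ * s) ≤ (Hs / s) ^ 2 + B ∧
      (∀ (j : ℕ) (u : ℂ), j ∉ E → St η f x₀ s hmax R Hs B j u →
        Ready η f x₀ s hmax R Hs B j u ∨ Frozen η f x₀ s hmax R Hs B j u) ∧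
      (∀ (j : ℕ) (u : ℂ), j ∈ E → St η f x₀ s hmax R Hs B j u → ¬ Ready η f x₀ s hmax R Hs B j u →
        ∃ u' : ℂ, St η f x₀ s hmax R Hs B (j + 1) u' ∧ |u'.im| ≤ |u.im| + lam j)

/-- `descentSigC_of_liftV_pieces` — seam of the TiltedLandingLaw421 descent framework, part 06 (token-identical port of `Cruxes/TiltedLandingLaw421/Lines/law421birthS.lean`; no new mathematics). -/
theorem descentSigC_of_liftV_pieces (μ c : ℝ) (hμ : 0 < μ) (hc : 0 ≤ c)
    (hbud : ∀ s hmax : ℝ, 0 < s → 2 * s ≤ hmax → hmax / (μ * s) ≤ 4 * hmax / s + c)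
    (St Ready Frozen : StatePred)
    (hI : Init0Sig St) (hSL : SurplusLiftSigV μ St Ready Frozen) (hF : FrozenStepSig μ St Ready Frozen)
    (hL : LandSig St Ready) : DescentSigC c := by
  intro η f x₀ s hmax R Hs B hE
  have hE' := hE
  obtain ⟨-, -, -, hs, hsh, -, -, -, -, -, -, -, -, -, -, -⟩ := hE'
  have hμs : 0 < μ * s := mul_pos hμ hs
  obtain ⟨E, lam, hlam0, hEsum, hEoff, hEon⟩ := hSL η f x₀ s hmax R Hs B hE
  obtain ⟨u₀, hSt0, hu₀⟩ := hI η f x₀ s hmax R Hs B hE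

  let S : ℕ → Finset ℕ := fun j => E.filter (fun e => j ≤ e)
  let w : ℕ → ℝ := fun e => 1 + lam e / (μ * s)
  let W : ℕ → ℝ := fun j => ∑ e ∈ S j, w e
  let Φ : ℕ → ℂ → ℝ := fun j u => |u.im| / (μ * s) + W j
  have hw0 : ∀ e, 0 ≤ w e := fun e => by
    have : 0 ≤ lam e / (μ * s) := div_nonneg (hlam0 e) hμs.le
    simp only [w]; linarith
  have hSins : ∀ j : ℕ, j ∈ E → S j = insert j (S (j + 1)) := by
    intro j hj
    ext e
    simp only [S, Finset.mem_filter, Finset.mem_insert]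
    constructor
    · rintro ⟨he, hle⟩
      by_cases h : e = j
      · exact Or.inl h
      · exact Or.inr ⟨he, by omega⟩
    · rintro (h | ⟨he, hle⟩)
      · subst h; exact ⟨hj, le_rfl⟩
      · exact ⟨he, by omega⟩
  have hSeq : ∀ j : ℕ, j ∉ E → S (j + 1) = S j := by
    intro j hj
    ext e
    simp only [S, Finset.mem_filter]
    constructor
    · rintro ⟨he, hle⟩; exact ⟨he, by omega⟩
    · rintro ⟨he, hle⟩
      have hne : j ≠ e := fun h => hj (h ▸ he)
      exact ⟨he, by omega⟩
  have hWon : ∀ j : ℕ, j ∈ E → W j = w j + W (j + 1) := by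
    intro j hj
    have hnot : j ∉ S (j + 1) := by
      simp only [S, Finset.mem_filter, not_and, not_le]
      intro _; omega
    simp only [W]
    rw [hSins j hj, Finset.sum_insert hnot]
  have hWoff : ∀ j : ℕ, j ∉ E → W (j + 1) = W j := by
    intro j hj
    simp only [W]
    rw [hSeq j hj]
  have hWnonneg : ∀ j, 0 ≤ W j := fun j => Finset.sum_nonneg (fun e _ => hw0 e)
  have hΦnonneg : ∀ (j : ℕ) (u : ℂ), 0 ≤ Φ j u := by
    intro j u
    have : 0 ≤ |u.im| / (μ * s) := div_nonneg (abs_nonneg _) hμs.le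
    have := hWnonneg j
    simp only [Φ]
    linarith

  have hStep : ∀ (j : ℕ) (u : ℂ), St η f x₀ s hmax R Hs B j u → ¬ Ready η f x₀ s hmax R Hs B j u →
      ∃ u' : ℂ, St η f x₀ s hmax R Hs B (j + 1) u' ∧ 0 ≤ Φ (j + 1) u' ∧ Φ (j + 1) u' + 1 ≤ Φ j u := by
    intro j u hSt hR
    by_cases hjE : j ∈ E
    ·
      obtain ⟨u', hSt', hle⟩ := hEon j u hjE hSt hR
      have hWj := hWon j hjE
      have hh : |u'.im| / (μ * s) ≤ |u.im| / (μ * s) + lam j / (μ * s) := by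
        rw [← add_div]
        exact div_le_div_of_nonneg_right hle hμs.le
      refine ⟨u', hSt', hΦnonneg _ _, ?_⟩
      simp only [Φ]
      simp only [w] at hWj
      linarith
    ·
      rcases hEoff j u hjE hSt with hRj | hFz
      · exact absurd hRj hR
      obtain ⟨u', hSt', hdrop⟩ := hF η f x₀ s hmax R Hs B hE j u hSt hFz hR
      have hh : |u'.im| / (μ * s) + 1 ≤ |u.im| / (μ * s) := by
        rw [← sub_nonneg]
        have hne : μ * s ≠ 0 := ne_of_gt hμs
        have : |u.im| / (μ * s) - (|u'.im| / (μ * s) + 1) = (|u.im| - |u'.im| - μ * s) / (μ * s) := by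
          field_simp
          ring
        rw [this]
        exact div_nonneg (by linarith) hμs.le
      have hWj := hWoff j hjE
      refine ⟨u', hSt', hΦnonneg _ _, ?_⟩
      simp only [Φ]
      linarith

  have hW0 : W 0 ≤ (Hs / s) ^ 2 + B := by
    have hsub : S 0 ⊆ E := Finset.filter_subset _ _
    have h1 : W 0 ≤ ∑ e ∈ E, w e := Finset.sum_le_sum_of_subset_of_nonneg hsub (fun e _ _ => hw0 e)
    have h2 : ∑ e ∈ E, w e = (E.card : ℝ) + (∑ e ∈ E, lam e) / (μ * s) := by
      simp only [w, Finset.sum_add_distrib, Finset.sum_const, nsmul_eq_mul, mul_one, Finset.sum_div]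
    linarith
  have hΦ0 : Φ 0 u₀ ≤ 4 * hmax / s + (Hs / s) ^ 2 + B + c := by
    have h1 : |u₀.im| / (μ * s) ≤ hmax / (μ * s) := div_le_div_of_nonneg_right hu₀ hμs.le
    have h2 := hbud s hmax hs hsh
    simp only [Φ]
    linarith
  obtain ⟨j, u, hj, hSt, hR⟩ :=
    descent_core (St := St η f x₀ s hmax R Hs B) (Ready := Ready η f x₀ s hmax R Hs B) (Φ := Φ)
      hStep hSt0 hΦ0 (allowance_nonneg hs hsh hc)
  obtain ⟨hnz, α, β, H, hα, hβ, hW⟩ := hL η f x₀ s hmax R Hs B hE j u hSt hR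
  exact ⟨j, α, β, H, hj, hα, hβ, hnz, hW⟩

/-- `descentSigS_of_liftV_pieces` — seam of the TiltedLandingLaw421 descent framework, part 06 (token-identical port of `Cruxes/TiltedLandingLaw421/Lines/law421birthS.lean`; no new mathematics). -/
theorem descentSigS_of_liftV_pieces (μ : ℝ) (hμ : 1 / 4 ≤ μ) (St Ready Frozen : StatePred)
    (hI : Init0Sig St) (hSL : SurplusLiftSigV μ St Ready Frozen) (hF : FrozenStepSig μ St Ready Frozen)
    (hL : LandSig St Ready) : DescentSigS :=
  descentSigS_of_descentSigC
    (descentSigC_of_liftV_pieces μ 0 (by linarith) le_rfl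
      (fun s hmax hs hsh => by
        have h1 : hmax / (μ * s) ≤ hmax / (1 / 4 * s) :=
          div_le_div_of_nonneg_left (by linarith) (by positivity) (mul_le_mul_of_nonneg_right hμ hs.le)
        have h2 : hmax / (1 / 4 * s) = 4 * hmax / s := by
          rw [div_eq_div_iff (by positivity) (ne_of_gt hs)]; ring
        linarith)
      St Ready Frozen hI hSL hF hL)

/-- `descentSigS'_of_liftV_pieces` — seam of the TiltedLandingLaw421 descent framework, part 06 (token-identical port of `Cruxes/TiltedLandingLaw421/Lines/law421birthS.lean`; no new mathematics). -/
theorem descentSigS'_of_liftV_pieces (μ : ℝ) (hμ : 1 / 4 ≤ μ) (St Ready Frozen : StatePred)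
    (hI : Init0Sig St) (hSL : SurplusLiftSigV μ St Ready Frozen) (hF : FrozenStepSig μ St Ready Frozen)
    (hL : LandSig St Ready) : DescentSigS' :=
  descentSigS'_of_descentSigS (descentSigS_of_liftV_pieces μ hμ St Ready Frozen hI hSL hF hL)

end Lift
/-- `StZero` — seam of the TiltedLandingLaw421 descent framework, part 06 (token-identical port of `Cruxes/TiltedLandingLaw421/Lines/law421birthS.lean`; no new mathematics). -/
def StZero : StatePred := fun _η f _x₀ _s _hmax _R _Hs _B j u => iteratedDeriv j f ≠ 0 ∧ iteratedDeriv j f u = 0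

/-- `WindowReady` — seam of the TiltedLandingLaw421 descent framework, part 06 (token-identical port of `Cruxes/TiltedLandingLaw421/Lines/law421birthS.lean`; no new mathematics). -/
def WindowReady : StatePred := fun _η f x₀ _s _hmax R _Hs _B j _u =>
  ∃ (α β H : ℝ), x₀ - (j + 3) * R / 2 ≤ α ∧ β ≤ x₀ + (j + 3) * R / 2 ∧ SignWindow (iteratedDeriv j f) α β H

/-- `ClearBoxReady` — seam of the TiltedLandingLaw421 descent framework, part 06 (token-identical port of `Cruxes/TiltedLandingLaw421/Lines/law421birthS.lean`; no new mathematics). -/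
def ClearBoxReady : StatePred := fun _η f x₀ _s _hmax R _Hs _B j _u =>
  ∃ (α β H : ℝ), x₀ - (j + 3) * R / 2 ≤ α ∧ β ≤ x₀ + (j + 3) * R / 2 ∧ ShadowFreeWindow (iteratedDeriv j f) α β H

/-- `init0Sig_stZero` — seam of the TiltedLandingLaw421 descent framework, part 06 (token-identical port of `Cruxes/TiltedLandingLaw421/Lines/law421birthS.lean`; no new mathematics). -/
theorem init0Sig_stZero : Init0Sig StZero := by
  intro η f x₀ s hmax R Hs B hE
  obtain ⟨-, -, -, -, -, -, -, hHs, hstrip, -, ⟨w₀, hw0, -, -, hwh⟩, -⟩ := hE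
  refine ⟨w₀, ⟨?_, ?_⟩, hwh⟩
  · intro hf0
    rw [iteratedDeriv_zero] at hf0
    have h := hstrip ((Hs + 1 : ℝ) * I) (by rw [hf0]; rfl)
    have him : (((Hs + 1 : ℝ) : ℂ) * I).im = Hs + 1 := by simp
    rw [him, abs_of_nonneg (by linarith)] at h
    linarith
  · rw [iteratedDeriv_zero]; exact hw0

/-- `landSig_windowReady` — seam of the TiltedLandingLaw421 descent framework, part 06 (token-identical port of `Cruxes/TiltedLandingLaw421/Lines/law421birthS.lean`; no new mathematics). -/
theorem landSig_windowReady (St : StatePred)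
    (hSt : ∀ η f x₀ s hmax R Hs B j u, St η f x₀ s hmax R Hs B j u → iteratedDeriv j f ≠ 0) :
    LandSig St WindowReady := by
  intro η f x₀ s hmax R Hs B _ j u hS hR
  exact ⟨hSt η f x₀ s hmax R Hs B j u hS, hR⟩

/-- `landSig_clearBoxReady` — seam of the TiltedLandingLaw421 descent framework, part 06 (token-identical port of `Cruxes/TiltedLandingLaw421/Lines/law421birthS.lean`; no new mathematics). -/
theorem landSig_clearBoxReady (hSign : OffJensenSignSig) (hHer : AnalyticHereditySig) (St : StatePred)
    (hSt : ∀ η f x₀ s hmax R Hs B j u, St η f x₀ s hmax R Hs B j u → iteratedDeriv j f ≠ 0) :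
    LandSig St ClearBoxReady := by
  intro η f x₀ s hmax R Hs B hE j u hS hR
  obtain ⟨hdiff, hreal, hgrowth, -, -, -, -, hHs, hstrip, -⟩ := hE
  have hC0 : InClass f Hs := ⟨hdiff, hreal, hgrowth, hstrip⟩
  have hnz : iteratedDeriv j f ≠ 0 := hSt η f x₀ s hmax R Hs B j u hS
  obtain ⟨α, β, H, hα, hβ, hW⟩ := hR
  obtain ⟨hlt, hH, hgα, hgβ, hdα, hdβ, hTop, hL, hRt, hA, hz⟩ := hW
  have hCj : InClass (iteratedDeriv j f) Hs := hHer f Hs j hHs hC0 hnz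
  have hsome : ∃ v : ℂ, iteratedDeriv j f v = 0 := by
    obtain ⟨ρ, -, hρ, -⟩ := hz
    exact ⟨ρ, hρ⟩
  refine ⟨hnz, α, β, H, hα, hβ, hlt, hH, hgα, hgβ, hdα, hdβ, ?_, ?_, ?_, hA, hz⟩
  · exact fun x hx ↦ hSign _ Hs _ hCj hnz hsome (by rw [Literature.Analysis.Complex.im_ofReal_add_ofReal_mul_I]; exact hH) (hTop x hx)
  · exact fun y hy ↦ hSign _ Hs _ hCj hnz hsome (by rw [Literature.Analysis.Complex.im_ofReal_add_ofReal_mul_I]; exact hy.1) (hL y hy)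
  · exact fun y hy ↦ hSign _ Hs _ hCj hnz hsome (by rw [Literature.Analysis.Complex.im_ofReal_add_ofReal_mul_I]; exact hy.1) (hRt y hy)

/-- `law421T_of_three_pieces` — seam of the TiltedLandingLaw421 descent framework, part 06 (token-identical port of `Cruxes/TiltedLandingLaw421/Lines/law421birthS.lean`; no new mathematics). -/
private theorem law421T_of_three_pieces (μ : ℝ) (hμ : 1 / 4 ≤ μ) (St Frozen : StatePred)
    (hSt : ∀ η f x₀ s hmax R Hs B j u, St η f x₀ s hmax R Hs B j u → iteratedDeriv j f ≠ 0)
    (hI : Init0Sig St) (hSur : SurplusSig 0 St ClearBoxReady Frozen) (hF : FrozenStepSig μ St ClearBoxReady Frozen)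
    (hH : HoldStepSig St ClearBoxReady) (hSign : OffJensenSignSig) (hHer : AnalyticHereditySig) :
    RhW07.Seam.Law421Statement :=
  law421T_of_surplus_pieces μ hμ St ClearBoxReady Frozen hI hSur hF hH (landSig_clearBoxReady hSign hHer St hSt) hHer

end RhIdea6.G19.W07C11.Seam
namespace RhIdea6.G19.W07C11.Seam
open Set Complex
open scoped ComplexConjugate
open RhIdea6.G17.W07C7 RhIdea6.G17.W07C7.Rev6 RhIdea6.G18.W07C8.Law421BirthS
open RhW07.C11.DescentSplit.C3
/-- `cStar` — seam of the TiltedLandingLaw421 descent framework, part 06 (token-identical port of `Cruxes/TiltedLandingLaw421/Lines/law421birthS.lean`; no new mathematics). -/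
noncomputable def cStar : ℝ := 1 / 4

/-- `muF` — seam of the TiltedLandingLaw421 descent framework, part 06 (token-identical port of `Cruxes/TiltedLandingLaw421/Lines/law421birthS.lean`; no new mathematics). -/
noncomputable def muF : ℝ := 1 / Real.pi

/-- `StWin` — seam of the TiltedLandingLaw421 descent framework, part 06 (token-identical port of `Cruxes/TiltedLandingLaw421/Lines/law421birthS.lean`; no new mathematics). -/
def StWin : StatePred := fun _η f x₀ _s hmax R _Hs _B j u =>
  iteratedDeriv j f ≠ 0 ∧ iteratedDeriv j f u = 0 ∧ 0 < u.im ∧ |u.re - x₀| ≤ ((j : ℝ) + 2) * R / 2 ∧ u.im ≤ hmax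


end RhIdea6.G19.W07C11.Seam
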